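import Summits.CriticalPhenomena.PercolationContinuityZ3.Theses.PercNonProliferation

/-!
# Sketch — crux-ideate r1 ideator 3, crux `NonProliferation` (stmt-CriticalPhenomena-4444)

First lemmas / transfer targets of the two idea cards, typed over existing declarations
(no proofs claimed; every `def … : Prop` elaborates):

* card `merger-budget`: `repsGen`, `meanCrossers`, `mergeAt`, `createAt`, `flowGe`, `pivotalFor`,
  `DeltaGeNegOne` (opening one edge kills at most one crosser), `RussoCountIdentity`,
  `PeierlsEndpoint`, `RussoBudgetFlow`, `MergerBudgetReduction` (the conditional closing).
* card `ratio-free-blocking`: `LongAnnulusBlocking R`, `PatchUnionBound`, `RatioFreeTransfer`,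
  `ShellProduct`.
-/

open MeasureTheory Filter Set
open Literature.Probability.LatticeModels Literature.Probability.Percolation

noncomputable section

namespace Summit.CriticalPhenomena.PercolationContinuityZ3.Cruxes.NonProliferation.Ideator3

/-- the bond measure on `ℤ³` at a real parameter `q` (projected into `[0,1]`). -/
abbrev μq (q : ℝ) : Measure (BondConfig (Site 3)) :=
  bondPercolation (zdGraph 3) (Set.projIcc (0:ℝ) 1 zero_le_one q)

/-- the critical measure. -/
abbrev μc : Measure (BondConfig (Site 3)) := bondPercolation (zdGraph 3) (criticalProbI 3)

/-- `k+1` pairwise-unjoined representatives of clusters of the open graph induced on `B(outer)`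
that meet `B(inner)` and `∂⁻B(outer)`; with `outer = 2*n` this is the event negated in the crux
(`N_n ≥ k+1`). -/
def repsGen (k inner outer : ℕ) : Set (BondConfig (Site 3)) :=
  {ω | ∃ x : Fin (k + 1) → Site 3, (∀ i, x i ∈ box 3 inner) ∧
    (∀ i, ∃ y ∈ innerBoundary (zdGraph 3) (box 3 outer), ω ∈ openConnIn ↑(box 3 outer) (x i) y) ∧
    ∀ i j, i ≠ j → ω ∉ openConnIn ↑(box 3 outer) (x i) (x j)}

/-- sanity: the crux is literally `∃ M c, 0 < c ∧ ∃ᶠ n, c ≤ μc.real (repsGen M n (2n))ᶜ`. -/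
example : Summit.CriticalPhenomena.PercolationContinuityZ3.Theses.PercNonProliferation.NonProliferation
    ↔ ∃ (M : ℕ) (c : ℝ), 0 < c ∧ ∃ᶠ n : ℕ in atTop, c ≤ μc.real (repsGen M n (2 * n))ᶜ :=
  Iff.rfl

/-- `E_q[N_n] = Σ_{k < |B(n)|} P_q(N_n ≥ k+1)` (layer cake; `N_n ≤ |B(n)|`). -/
def meanCrossers (q : ℝ) (n : ℕ) : ℝ :=
  ∑ k ∈ Finset.range (box 3 n).card, (μq q).real (repsGen k n (2 * n))

/-- the cluster of `x` in `ω` (induced on `B(2n)`) is a crosser: joined inside `B(2n)` to `B(n)`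
and to `∂⁻B(2n)`. -/
def isCrosserAt (n : ℕ) (x : Site 3) : Set (BondConfig (Site 3)) :=
  {ω | (∃ a ∈ box 3 n, ω ∈ openConnIn ↑(box 3 (2 * n)) x a) ∧
       ∃ b ∈ innerBoundary (zdGraph 3) (box 3 (2 * n)), ω ∈ openConnIn ↑(box 3 (2 * n)) x b}

/-- MERGE event at the edge `s(x,y)`: in `ω ∖ {s(x,y)}` the endpoints lie in two DISTINCT
crossers (opening the edge lowers `N_n` by exactly one). Independent of the state of the edge. -/
def mergeAt (n : ℕ) (x y : Site 3) : Set (BondConfig (Site 3)) :=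
  {ω | ω \ {s(x, y)} ∈ isCrosserAt n x ∧ ω \ {s(x, y)} ∈ isCrosserAt n y ∧
       ω \ {s(x, y)} ∉ openConnIn ↑(box 3 (2 * n)) x y}

/-- CREATE event at `s(x,y)`: neither endpoint-cluster of `ω ∖ {e}` is a crosser but their
union (the cluster of `x` in `ω ∪ {e}`) is (opening the edge raises `N_n` by exactly one). -/
def createAt (n : ℕ) (x y : Site 3) : Set (BondConfig (Site 3)) :=
  {ω | ω \ {s(x, y)} ∉ isCrosserAt n x ∧ ω \ {s(x, y)} ∉ isCrosserAt n y ∧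
       insert s(x, y) ω ∈ isCrosserAt n x}

/-- the ORDERED nearest-neighbour pairs of `ℤ³` with both endpoints in `B(2n)`; every edge
appears twice, so edge sums are written `(1/2) * Σ_{(x,y) ∈ boxPairs n} f x y` (the summands
below are symmetric in `(x,y)`). -/
def boxPairs (n : ℕ) : Finset (Site 3 × Site 3) :=
  ((box 3 (2 * n)) ×ˢ (box 3 (2 * n))).filter (fun q => (zdGraph 3).Adj q.1 q.2)

/-- the corresponding unordered edges. -/
def boxEdges (n : ℕ) : Finset (Sym2 (Site 3)) := (boxPairs n).image (fun q => s(q.1, q.2))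

/-- (A0) opening one edge kills at most one crosser: `{N ≥ M+2} ⊆ {N(ω ∪ e) ≥ M+1}`. Provable now. -/
def DeltaGeNegOne : Prop :=
  ∀ (M n : ℕ) (e : Sym2 (Site 3)) (ω : BondConfig (Site 3)),
    ω ∈ repsGen (M + 1) n (2 * n) → insert e ω ∈ repsGen M n (2 * n)

/-- (A1) Russo's formula for the NON-monotone count, integrated from `p_c` to `p₁`:
`E_{p_c} N_n = E_{p₁} N_n + ∫_{p_c}^{p₁} Σ_e (P_q(merge_e) − P_q(create_e)) dq`. Provable now
(Russo for functions of finitely many edges; `Δ_e N ∈ {−1,0,1}` with `−1` iff merge, `+1` iff create). -/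
def RussoCountIdentity : Prop :=
  ∀ (n : ℕ) (p₁ : ℝ), (criticalProbI 3 : ℝ) < p₁ → p₁ < 1 →
    meanCrossers (criticalProbI 3) n = meanCrossers p₁ n +
      ∫ q in Set.Ioo (criticalProbI 3 : ℝ) p₁,
        (1 / 2 : ℝ) * ∑ xy ∈ boxPairs n,
          ((μq q).real (mergeAt n xy.1 xy.2) - (μq q).real (createAt n xy.1 xy.2))

/-- (A2) Peierls endpoint: for `p₁` close to `1` two distinct crossers need a closed *-connected
edge cutset of size `≥ c n^{2/3}` (box isoperimetry + Timár boundary connectivity), hence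
`E_{p₁} N_n ≤ 1 + o(1)`; stated as `Σ_{k ≥ 1} P_{p₁}(N_n ≥ k+1) → 0`. Provable now. -/
def PeierlsEndpoint : Prop :=
  ∃ p₁ : ℝ, (criticalProbI 3 : ℝ) < p₁ ∧ p₁ < 1 ∧
    Tendsto (fun n : ℕ => ∑ k ∈ Finset.Ico 1 (box 3 n).card, (μq p₁).real (repsGen k n (2 * n)))
      atTop (nhds 0)

/-- the increasing event "at least `j` pairwise vertex-disjoint open lattice paths inside `B(2n)`
from the vertex set `Q` to the vertex set `Q'`" (max-flow `D(Q,Q') ≥ j`). -/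
def flowGe (n j : ℕ) (Q Q' : Set (Site 3)) : Set (BondConfig (Site 3)) :=
  {ω | ∃ (u v : Fin j → Site 3) (w : ∀ i, (zdGraph 3).Walk (u i) (v i)),
    (∀ i, u i ∈ Q ∧ v i ∈ Q') ∧ (∀ i, ∀ e ∈ (w i).edges, e ∈ ω) ∧
    (∀ i, ∀ z ∈ (w i).support, z ∈ box 3 (2 * n)) ∧
    ∀ i i', i ≠ i' → Disjoint (w i).support.toFinset (w i').support.toFinset}

/-- `e` is pivotal for the event `F` (state of `e` decides `F`). -/
def pivotalFor (F : Set (BondConfig (Site 3))) (e : Sym2 (Site 3)) : Set (BondConfig (Site 3)) :=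
  {ω | insert e ω ∈ F ∧ ω \ {e} ∉ F}

/-- (A3) Russo budget: the integrated pivotal intensity of ONE increasing finitary event is at
most `1`, whatever the window — here for the flow events. Provable now (Russo + `0 ≤ P ≤ 1`). -/
def RussoBudgetFlow : Prop :=
  ∀ (n j : ℕ) (Q Q' : Set (Site 3)) (a b : ℝ), 0 < a → a ≤ b → b < 1 →
    ∫ q in Set.Ioo a b, ∑ e ∈ boxEdges n, (μq q).real (pivotalFor (flowGe n j Q Q') e)
      ≤ 1

/-- grid cell of side `ℓ` with lower corner `ℓ • g`. -/
def cell (ℓ : ℕ) (g : Site 3) : Set (Site 3) := {z | ∀ i, (ℓ : ℤ) * g i ≤ z i ∧ z i < (ℓ : ℤ) * (g i + 1)}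

/-- (A4) grid pivotality (deterministic): if the two merging crossers are `K`-SEPARABLE — some cell
`Q` of side `⌈n/K⌉` meets the cluster of `x` but not that of `y`, some cell `Q'` at sup-distance
`≥ n/4` meets the cluster of `y` but not that of `x` — then `e = s(x,y)` is pivotal for
`flowGe n (j+1) Q Q'` where `j` is the current flow (the `j` existing disjoint `Q–Q'` paths lie in
clusters other than the two merging ones, since the cluster of `x` misses `Q'` and that of `y` misses
`Q`; the merged cluster adds one more through `e`). Stated for lattice configurations and a lattice
edge `e = s(x,y)`: merge ∧ separable by `(Q,Q')` ∧ `flowGe j` ∧ `¬ flowGe (j+1)` in `ω ∖ e` ⇒ `e`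
pivotal for level `j+1`. Provable now. -/
def GridPivotality : Prop :=
  ∀ (n j : ℕ) (x y : Site 3) (Q Q' : Set (Site 3)) (ω : BondConfig (Site 3)),
    ω ⊆ (zdGraph 3).edgeSet → (zdGraph 3).Adj x y →
    ω ∈ mergeAt n x y →
    (∃ a ∈ Q, ω \ {s(x, y)} ∈ openConnIn ↑(box 3 (2 * n)) x a) →
    (∀ a ∈ Q', ω \ {s(x, y)} ∉ openConnIn ↑(box 3 (2 * n)) x a) →
    (∃ b ∈ Q', ω \ {s(x, y)} ∈ openConnIn ↑(box 3 (2 * n)) y b) →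
    (∀ b ∈ Q, ω \ {s(x, y)} ∉ openConnIn ↑(box 3 (2 * n)) y b) →
    Q ⊆ ↑(box 3 (2 * n)) → Q' ⊆ ↑(box 3 (2 * n)) →
    ω \ {s(x, y)} ∈ flowGe n j Q Q' →
    ω \ {s(x, y)} ∉ flowGe n (j + 1) Q Q' → ω ∈ pivotalFor (flowGe n (j + 1) Q Q') s(x, y)

/-- the BAD merge events of card A at grid scale `K`, flow level `J`: merge at `s(x,y)` such that
for every pair of cells (side `⌈n/K⌉`, sup-distance of corners `≥ n/4`) separating the two
crossers, the punctured configuration already carries `J` disjoint `Q–Q'` paths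
(this includes the SHADOW case, where no separating pair exists). -/
def badMerge (K J n : ℕ) (x y : Site 3) : Set (BondConfig (Site 3)) :=
  {ω | ω ∈ mergeAt n x y ∧ ∀ g g' : Site 3,
    (let ℓ := (n + K - 1) / K
     let Q := cell ℓ g ∩ ↑(box 3 (2 * n))
     let Q' := cell ℓ g' ∩ ↑(box 3 (2 * n))
     ((∃ a ∈ Q, ω \ {s(x, y)} ∈ openConnIn ↑(box 3 (2 * n)) x a) ∧
      (∀ a ∈ Q', ω \ {s(x, y)} ∉ openConnIn ↑(box 3 (2 * n)) x a) ∧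
      (∃ b ∈ Q', ω \ {s(x, y)} ∈ openConnIn ↑(box 3 (2 * n)) y b) ∧
      (∀ b ∈ Q, ω \ {s(x, y)} ∉ openConnIn ↑(box 3 (2 * n)) y b) ∧
      (n : ℤ) ≤ 4 * (ℓ : ℤ) * (Finset.univ.sup' Finset.univ_nonempty fun i => |g i - g' i|))
     → ω \ {s(x, y)} ∈ flowGe n J Q Q')}

/-- (A5) THE REDUCTION (conditional closing of the crux by card A): if for some grid `K` and flow
level `J` the integrated intensity of BAD merges stays bounded along a subsequence, then
`NonProliferation`. (From (A1)–(A4): `E_{p_c} N_n ≤ 1 + o(1) + (8K+2)^6 J + ∫ bad`, then Markov.) -/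
def MergerBudgetReduction : Prop :=
  (∃ (K J : ℕ) (p₁ B : ℝ), (criticalProbI 3 : ℝ) < p₁ ∧ p₁ < 1 ∧
    ∃ᶠ n : ℕ in atTop,
      ∫ q in Set.Ioo (criticalProbI 3 : ℝ) p₁,
        (1 / 2 : ℝ) * ∑ xy ∈ boxPairs n, (μq q).real (badMerge K J n xy.1 xy.2) ≤ B) →
  Summit.CriticalPhenomena.PercolationContinuityZ3.Theses.PercNonProliferation.NonProliferation

/-! ### ratio-free blocking (NOT filed as a card: the covering transfer below coincides with
`covering_reduction` of the already-published crux idea `avoidance-cost-covering`; kept as a typed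
record, `ShellProduct` being the one extra remark) -/

/-- blocking of ONE long annulus with positive probability, frequently: `u_m(R) ≥ ε`. -/
def LongAnnulusBlocking (R : ℕ) : Prop :=
  ∃ ε : ℝ, 0 < ε ∧ ∃ᶠ m : ℕ in atTop, ε ≤ μc.real (repsGen 0 m (R * m))ᶜ

/-- (B1) patch union bound (mid-sphere pigeonhole + translation invariance): many crossers at
aspect ratio 2 force proportionally many crossers of a translated annulus of aspect ratio `R`;
typed at the standard position. Provable now. -/
def PatchUnionBound : Prop :=
  ∀ R : ℕ, 2 ≤ R → ∃ A C : ℕ, 0 < A ∧ 0 < C ∧ ∀ m k : ℕ, 1 ≤ m →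
    μc.real (repsGen (C * (k + 1)) (A * m) (2 * (A * m))) ≤ C * μc.real (repsGen k m (R * m))

/-- (B2) BK at aspect ratio `R` (the route's `SpanningBKCap` with `2n ↦ R m`). Provable now. -/
def SpanningBKCapR : Prop :=
  ∀ (R k m : ℕ), μc.real (repsGen k m (R * m)) ≤ (μc.real (repsGen 0 m (R * m))) ^ (k + 1)

/-- (B3) the transfer: blocking at ANY ONE aspect ratio implies the crux. Provable now from
(B1)+(B2) (`M := C (k+1) − 1` with `C (1−ε)^{k+1} ≤ 1/2`). -/
def RatioFreeTransfer : Prop :=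
  ∀ R : ℕ, 2 ≤ R → LongAnnulusBlocking R →
    Summit.CriticalPhenomena.PercolationContinuityZ3.Theses.PercNonProliferation.NonProliferation

/-- (B4) dyadic-shell independence: crossing `A(m, 2^L m)` inside `B(2^L m)` forces a crossing of
each shell `A(2^j m, 2^{j+1} m)` INSIDE THE CLOSED SHELL, and the shells use disjoint edges, so
`1 − u_m(2^L) ≤ ∏_{j<L} (1 − u'_{2^j m})` with the shell-blocking probability `u'`. Provable now. -/
def ShellProduct : Prop :=
  ∀ (L m : ℕ), 1 ≤ m →
    μc.real (repsGen 0 m (2 ^ L * m)) ≤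
      ∏ j ∈ Finset.range L, μc.real {ω | ∃ x ∈ box 3 (2 ^ j * m),
        ∃ y ∈ innerBoundary (zdGraph 3) (box 3 (2 ^ (j + 1) * m)),
          ω ∈ openConnIn (↑(box 3 (2 ^ (j + 1) * m)) \ ↑(box 3 (2 ^ j * m - 1))) x y}

end Summit.CriticalPhenomena.PercolationContinuityZ3.Cruxes.NonProliferation.Ideator3

end
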